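import Literature.RingTheory.Etale.FiniteEtaleAlgebraPerfectRing
import Mathlib.Algebra.CharP.Lemmas
import Mathlib.RingTheory.Artinian.Ring
import HarnessLib

/-!
# The `k`-span of the `q`-th powers: the image of the relative Frobenius in absolute currency ([StacksProject] Tag 0CC6, 00U3)

Topic `Literature/RingTheory/Etale`; namespace `Literature.RingTheory.Etale`.  PROOF FILE (theorems only; no definition, no named fact,
no instance, no notation, no `sorry`).  Cell `hodgecm-mathlib` (D-0151), FLOOR-0 P5a row G16 (F0P5a-plan (g5) 07:55:58Z): for a
`k`-algebra `B` of exponential characteristic `p` and `q = p ^ f`, the `k`-SPAN OF THE `q`-TH POWERS `span_k {x^q}` is the image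
of the relative Frobenius `F_{B∕k} : B^{(q)} → B` (which the P6 pen will define scheme-side); here we record, def-free, what the
MOD road needs from it ([MOD-ROAD-P″ add2, h0]): (q1) it is a subalgebra; (q2) «`F` kills» ⇔ the `q`-th powers vanish on an
ideal `I` with `B = k·1 + I`; (q3) over a PERFECT field, «`F` onto» ⇔ `B` étale (★ G14 `FiniteEtaleAlgebraPerfectRing`).

* `span_qPow_eq_adjoin_toSubmodule` — (q1) `(Algebra.adjoin k {x^q}).toSubmodule = span_k {x^q}`: the `q`-th powers form a
  submonoid (`(xy)^q = x^q y^q`, `1 = 1^q`), so their span is already a subalgebra (Mathlib `Algebra.adjoin_eq_span`).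
* **`span_qPow_eq_bot_iff_forall_pow_eq_zero`** — (q2) for an ideal `I ≠ ⊤` with `∀ b, ∃ c, b - c·1 ∈ I`:
  `span_k {x^q} = k·1 ⟺ ∀ x ∈ I, x^q = 0` (`(c·1 + i)^q = c^q·1 + i^q`, Mathlib `add_pow_expChar_pow`; no perfectness needed).
* `qPow_surjective_of_span_qPow_eq_top` (`k` perfect: the set of `q`-th powers is already a `k`-submodule, so «span = ⊤» means
  `x ↦ x^q` is onto), `isReduced_of_qPow_surjective` (`B` artinian, `2 ≤ q`: a surjective `q`-power map kills the nilradical), and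
  **`span_qPow_eq_top_iff_etale`** — (q3) over a perfect field, for `B` module-finite, `p` prime and `1 ≤ f`:
  `span_k {x^q} = ⊤ ⟺ B` étale over `k` (← by ★ G14 `iterateFrobenius_bijective_of_etale`; → by the two lemmas and ★ G9
  `etale_iff_isReduced_of_finite_of_perfectField`).

HC_CM is proved only modulo the 7 printed citations until rung 0 closes; this file is generic commutative algebra and changes no count.

## References
* [StacksProject] The Stacks Project, Tag 0CC6 (Algebra §10.46 «Perfect rings», relative Frobenius) and Tag 00U3 (Lemma 10.143.4,
  étale algebras over a field).
-/

set_option autoImplicit false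

noncomputable section

namespace Literature.RingTheory.Etale

universe u v

section QPow

variable (k : Type u) [Field k] (p : ℕ) [ExpChar k p] (B : Type v) [CommRing B] [Algebra k B] [ExpChar B p] (f : ℕ)

omit [ExpChar k p] [ExpChar B p] in
/-- (q1) **The span of the `q`-th powers is a subalgebra**: `(Algebra.adjoin k {x ^ q}).toSubmodule = span_k {x ^ q}` (`q = p ^ f`;
indeed for any exponent), since the `q`-th powers form a submonoid. [cite: StacksProject, Tag 0CC6] -/
theorem span_qPow_eq_adjoin_toSubmodule :
    Subalgebra.toSubmodule (Algebra.adjoin k (Set.range fun x : B => x ^ p ^ f)) =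
      Submodule.span k (Set.range fun x : B => x ^ p ^ f) := by
  rw [Algebra.adjoin_eq_span]
  congr 1
  have : (Set.range fun x : B => x ^ p ^ f) = (MonoidHom.mrange (powMonoidHom (p ^ f) : B →* B) : Set B) := by
    rw [MonoidHom.coe_mrange]; rfl
  rw [this, Submonoid.closure_eq]

/-- (q2) **«Frobenius kills» ⟺ the `q`-th powers vanish on the augmentation ideal.**  Let `I ≠ ⊤` be an ideal with `B = k·1 + I`
(e.g. the augmentation ideal of a Hopf algebra, or the maximal ideal of a local algebra with residue field `k`).  Then the span of
the `q`-th powers is `k·1` iff `x ^ q = 0` for all `x ∈ I`. [cite: StacksProject, Tag 0CC6] -/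
theorem span_qPow_eq_bot_iff_forall_pow_eq_zero (I : Ideal B) (hI : ∀ b : B, ∃ c : k, b - algebraMap k B c ∈ I) (hI' : I ≠ ⊤) :
    Submodule.span k (Set.range fun x : B => x ^ p ^ f) = Subalgebra.toSubmodule (⊥ : Subalgebra k B) ↔
      ∀ x ∈ I, x ^ p ^ f = 0 := by
  constructor
  · intro h x hx
    have hmem : x ^ p ^ f ∈ Subalgebra.toSubmodule (⊥ : Subalgebra k B) := by
      rw [← h]; exact Submodule.subset_span ⟨x, rfl⟩
    rw [Subalgebra.mem_toSubmodule, Algebra.mem_bot] at hmem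
    obtain ⟨c, hc⟩ := hmem
    -- `algebraMap c = x^q ∈ I` forces `c = 0`
    have hcI : algebraMap k B c ∈ I := by rw [hc]; exact Ideal.pow_mem_of_mem I hx _ (pow_pos (expChar_pos k p) f)
    by_cases hc0 : c = 0
    · rw [← hc, hc0, map_zero]
    · exact absurd (I.eq_top_of_isUnit_mem hcI ((IsUnit.mk0 c hc0).map _)) hI'
  · intro h
    apply le_antisymm
    · rw [Submodule.span_le]
      rintro _ ⟨b, rfl⟩
      obtain ⟨c, hc⟩ := hI b
      have hb : b = algebraMap k B c + (b - algebraMap k B c) := by ring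
      rw [SetLike.mem_coe, Subalgebra.mem_toSubmodule, Algebra.mem_bot]
      refine ⟨c ^ p ^ f, ?_⟩
      show algebraMap k B (c ^ p ^ f) = b ^ p ^ f
      rw [hb, add_pow_expChar_pow, h _ hc, add_zero, map_pow]
    · intro x hx
      rw [Subalgebra.mem_toSubmodule, Algebra.mem_bot] at hx
      obtain ⟨c, rfl⟩ := hx
      have : algebraMap k B c = c • (1 : B) ^ p ^ f := by rw [one_pow, Algebra.algebraMap_eq_smul_one]
      rw [this]
      exact Submodule.smul_mem _ _ (Submodule.subset_span ⟨1, rfl⟩)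

/-- Over a PERFECT field the set of `q`-th powers is already a `k`-submodule, so «`span_k {x^q} = ⊤`» means that `x ↦ x ^ q` is
SURJECTIVE. [cite: StacksProject, Tag 0CC6] -/
theorem qPow_surjective_of_span_qPow_eq_top [PerfectField k]
    (h : Submodule.span k (Set.range fun x : B => x ^ p ^ f) = ⊤) :
    Function.Surjective fun x : B => x ^ p ^ f := by
  haveI := PerfectField.toPerfectRing (K := k) p
  -- the `q`-th powers form a submodule
  let S : Submodule k B :=
    { carrier := Set.range fun x : B => x ^ p ^ f
      add_mem' := by
        rintro _ _ ⟨x, rfl⟩ ⟨y, rfl⟩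
        exact ⟨x + y, add_pow_expChar_pow x y p f⟩
      zero_mem' := ⟨0, zero_pow (pow_ne_zero _ (expChar_pos k p).ne')⟩
      smul_mem' := by
        rintro c _ ⟨x, rfl⟩
        obtain ⟨d, hd⟩ := (iterateFrobeniusEquiv k p f).surjective c
        refine ⟨d • x, ?_⟩
        show (d • x) ^ p ^ f = c • x ^ p ^ f
        rw [smul_pow, ← hd, coe_iterateFrobeniusEquiv, iterateFrobenius_def] }
  have hS : Submodule.span k (Set.range fun x : B => x ^ p ^ f) = S := Submodule.span_eq S
  intro y
  have hy : y ∈ S := by rw [← hS, h]; exact Submodule.mem_top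
  exact hy

/-- In an ARTINIAN commutative ring, if `x ↦ x ^ q` is surjective for some `q ≥ 2` then the ring is REDUCED (the nilradical is
nilpotent, and a nilpotent `q^m`-th power of high order vanishes). [cite: StacksProject, Tag 0CC6] -/
theorem isReduced_of_qPow_surjective {B : Type v} [CommRing B] [IsArtinianRing B] {q : ℕ} (hq : 2 ≤ q)
    (h : Function.Surjective fun x : B => x ^ q) : IsReduced B := by
  -- the iterates `x ↦ x^(q^m)` are surjective
  have hiter : ∀ m : ℕ, Function.Surjective fun x : B => x ^ q ^ m := by
    intro m
    induction m with
    | zero => intro y; exact ⟨y, by simp⟩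
    | succ m ih =>
        intro y
        obtain ⟨z, rfl⟩ := ih y
        obtain ⟨x, rfl⟩ := h z
        exact ⟨x, by simp only [pow_succ, pow_mul]; rw [← pow_mul, ← pow_mul, mul_comm]⟩
  obtain ⟨M, hM⟩ := IsArtinianRing.isNilpotent_nilradical (R := B)
  refine ⟨fun y hy => ?_⟩
  -- choose `m` with `q^m ≥ M` and write `y = x^(q^m)`
  have hle : M ≤ q ^ M := (Nat.lt_pow_self (by omega)).le
  obtain ⟨x, hx⟩ := hiter M y
  simp only at hx
  have hxnil : IsNilpotent x := by
    obtain ⟨r, hr⟩ := hy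
    exact ⟨q ^ M * r, by rw [pow_mul, hx, hr]⟩
  have hxM : x ^ M = 0 := by
    have : x ^ M ∈ (nilradical B) ^ M := Ideal.pow_mem_pow (mem_nilradical.2 hxnil) M
    rw [hM] at this
    exact (Submodule.mem_bot B).1 this
  obtain ⟨c, hc⟩ := Nat.exists_eq_add_of_le hle
  rw [← hx, hc, pow_add, hxM, zero_mul]

/-- (q3) **Over a perfect field, «relative Frobenius onto» ⟺ étale**: for `B` module-finite over a perfect field `k` of prime
characteristic exponent `p` and `q = p ^ f` with `1 ≤ f`, the `q`-th powers span `B` iff `B` is étale over `k`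
(← ★ G14; → the two lemmas above and ★ G9 «étale ⇔ reduced»). [cite: StacksProject, Tag 00U3] -/
theorem span_qPow_eq_top_iff_etale [PerfectField k] [Module.Finite k B] (hp : p.Prime) (hf : 1 ≤ f) :
    Submodule.span k (Set.range fun x : B => x ^ p ^ f) = ⊤ ↔ Algebra.Etale k B := by
  constructor
  · intro h
    haveI : IsArtinianRing B := IsArtinianRing.of_finite k B
    have hq : 2 ≤ p ^ f := by
      calc 2 ≤ p := hp.two_le
        _ = p ^ 1 := (pow_one p).symm
        _ ≤ p ^ f := Nat.pow_le_pow_right hp.pos hf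
    haveI := isReduced_of_qPow_surjective hq (qPow_surjective_of_span_qPow_eq_top k p B f h)
    exact (etale_iff_isReduced_of_finite_of_perfectField k B).2 ‹IsReduced B›
  · intro hB
    apply eq_top_iff.2
    intro y _
    obtain ⟨x, rfl⟩ := (iterateFrobenius_bijective_of_etale k p B f).2 y
    exact Submodule.subset_span ⟨x, (iterateFrobenius_def (R := B) p f x).symm⟩

end QPow

end Literature.RingTheory.Etale

end
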